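import Mathlib

/-!
# Quartic flip — the local halving law at inert primes: a complete computable verification for small `ℓ`
(crux idea `quartic-flip-kummer-kolyvagin`, support P2 `LocalHalvingLawAtInertPrimes`;
critic idea-crit-15 V#2 / V#22: "the in-Lean decide-checks remain the kit-free item the seat can still pay")

Seat `planner-bsd-idea-20-g11-0` (bsd-idea-20 g11), crux item stmt-BirchSwinnertonDyer-19804, 2026-08-28.
Imports only Mathlib; declares no instance, no notation.  No summit statement is proved by this file.

THE LAW (card P2).  `ℓ ≡ 3 (mod 4)` prime, `ℓ ∤ 2D`, `E_D : y² = x³ − D x`.  Then `ℓ` is inert in `F = ℚ(i)`,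
`E_D` is supersingular at `ℓ`, `E_D(𝔽_{ℓ²}) ≅ (ℤ/(ℓ+1))² ⊇ E_D[2]`, and for an `𝔽_ℓ`-rational point
`P = (x, y)` with `y ≠ 0`:
        `P ∈ 2·E_D(𝔽_{ℓ²})   ⟺   (x/ℓ) = +1  ∨  (D/ℓ) = +1`.
(Proof on paper: with `e₁ = 0, e₂ = √D, e₃ = −√D ∈ 𝔽_{ℓ²}`, `P ∈ 2E` iff `x − e_i` are squares in `𝔽_{ℓ²}`;
`x ∈ 𝔽_ℓ ⊂ 𝔽_{ℓ²}^{×2}`; if `√D ∈ 𝔽_ℓ` all three lie in `𝔽_ℓ`; else `x ∓ √D` is a square iff its norm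
`x² − D = y²/x` is a square in `𝔽_ℓ`, iff `x` is.)  It is the local index law at the lever's Kolyvagin primes:
`[2] = −i·(1+i)²`, so `2`-divisibility in `E_D(F_λ)` is `π²`-divisibility.

THE MODEL.  `𝔽_{ℓ²}` is realised as `𝔽_ℓ[i] = {a + b i}`, pairs of naturals `< ℓ` with `i² = −1`
(a field because `−1` is a non-residue for `ℓ ≡ 3 (mod 4)`: theorem `model_is_field`).  Everything is a
pure function on `ℕ`, evaluated natively (`native_decide`), in the style of `RedeiLayerMatchingCensus.lean`.
Since the law depends on `D` only through `D mod ℓ`, checking every residue `D ∈ {1, …, ℓ−1}` verifies it for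
ALL integers `D` with `ℓ ∤ D` at that prime.

RESULTS (kernel-accepted facts about these functions):
* `model_is_field`       — `r² + 1 ≢ 0 (mod ℓ)` for all `r`, for every `ℓ` in the lists below;
* `card_points_small`    — `#E_D(𝔽_ℓ[i]) = (ℓ + 1)²` for all `D ∈ [1, ℓ)`, `ℓ ∈ {3, 7, 11, 19, 23}` (supersingular count);
* `two_torsion_rational` — `x³ − D x` has three roots in `𝔽_ℓ[i]` (full 2-torsion over `𝔽_{ℓ²}`), same range;
* `halving_law_small`    — the law for every `D ∈ [1, ℓ)` and every affine `P ∈ E_D(𝔽_ℓ)`, `y ≠ 0`, `ℓ ∈ {3,7,11,19,23}`;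
* `halving_law_medium`   — the same for `ℓ ∈ {31, 43, 47, 59}` — together: EVERY prime `ℓ ≡ 3 (mod 4)` with `ℓ ≤ 59` (nine primes), every `D ≢ 0 (mod ℓ)`;
* `card_hand_example`    — the card's hand check at `(ℓ, D) = (7, 3)`: `(2,3)` halvable, `(6,3)` not;
* `blind_bit`            — at these `ℓ`, EVERY unit `x ∈ 𝔽_ℓ^×` is a square in `𝔽_ℓ[i]` (so the `(1+i)`-Kummer
                           image `δ_π(P) = x(P)` of a rational point with `ℓ ∤ x(P)` is locally trivial at `λ ∣ ℓ`: K1's blind bit).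
The BRIDGE "these functions compute `WeierstrassCurve` points over `GaloisField ℓ 2`" is not proved here
(Mathlib's `GaloisField` is noncomputable); the statement P2 in the card is over `ZMod ℓ` / `GaloisField ℓ 2`.
-/

set_option linter.dupNamespace false

namespace Summit.BirchSwinnertonDyer.BirchSwinnertonDyer.Cruxes.UpperOffV0HSYPlus.QuarticFlipKummer.HalvingCensus

/-- An element `a + b·i` of `𝔽_ℓ[i]`, stored as `(a, b)` with `a, b < ℓ`. -/
abbrev GI := ℕ × ℕ

def giAdd (ℓ : ℕ) (z w : GI) : GI := ((z.1 + w.1) % ℓ, (z.2 + w.2) % ℓ)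

def giNeg (ℓ : ℕ) (z : GI) : GI := ((ℓ - z.1 % ℓ) % ℓ, (ℓ - z.2 % ℓ) % ℓ)

def giSub (ℓ : ℕ) (z w : GI) : GI := giAdd ℓ z (giNeg ℓ w)

/-- `(a + b i)(c + d i) = (ac − bd) + (ad + bc) i`. -/
def giMul (ℓ : ℕ) (z w : GI) : GI :=
  ((z.1 * w.1 + ℓ * ℓ - (z.2 * w.2) % (ℓ * ℓ)) % ℓ, (z.1 * w.2 + z.2 * w.1) % ℓ)

def giOfNat (ℓ : ℕ) (n : ℕ) : GI := (n % ℓ, 0)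

def giSq (ℓ : ℕ) (z : GI) : GI := giMul ℓ z z

/-- All elements of `𝔽_ℓ[i]`. -/
def giAll (ℓ : ℕ) : List GI :=
  (List.range ℓ).flatMap fun a => (List.range ℓ).map fun b => (a, b)

def enc (ℓ : ℕ) (z : GI) : ℕ := z.1 * ℓ + z.2

/-- Table of NON-ZERO squares of `𝔽_ℓ[i]` (index `enc`). -/
def sqTable (ℓ : ℕ) : Array Bool :=
  (giAll ℓ).foldl (fun t v => if v = (0, 0) then t else t.set! (enc ℓ (giSq ℓ v)) true)
    (Array.replicate (ℓ * ℓ) false)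

def isNonzeroSquareGI (ℓ : ℕ) (t : Array Bool) (z : GI) : Bool := t.getD (enc ℓ z) false

/-- `x³ − D·x` in `𝔽_ℓ[i]` (`D` a natural, read mod `ℓ`). -/
def rhs (ℓ D : ℕ) (u : GI) : GI :=
  giSub ℓ (giMul ℓ u (giSq ℓ u)) (giMul ℓ (giOfNat ℓ D) u)

/-- Is `n` a square mod `ℓ` (including `0`)? -/
def isSqMod (ℓ n : ℕ) : Bool := (List.range ℓ).any fun r => r * r % ℓ == n % ℓ

/-- `P = (x, y) ∈ E_D(𝔽_ℓ)`, `y ≠ 0`, is halvable in `E_D(𝔽_ℓ[i])`: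
there is `Q = (u, v)` with `v ≠ 0` on the curve and `x(2Q) = x`, i.e. `(3u² − D)² = (x + 2u)·(2v)² = 4(x + 2u)(u³ − Du)`
with `u³ − Du` a non-zero square. -/
def halvable (ℓ D : ℕ) (t : Array Bool) (x : ℕ) : Bool :=
  (giAll ℓ).any fun u =>
    let w := rhs ℓ D u
    isNonzeroSquareGI ℓ t w &&
      (giSq ℓ (giSub ℓ (giMul ℓ (giOfNat ℓ 3) (giSq ℓ u)) (giOfNat ℓ D))
        == giMul ℓ (giOfNat ℓ 4) (giMul ℓ (giAdd ℓ (giOfNat ℓ x) (giAdd ℓ u u)) w))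

/-- Affine `𝔽_ℓ`-points `(x, y)` of `E_D` with `y ≠ 0`. -/
def ratPointsOddOrder (ℓ D : ℕ) : List (ℕ × ℕ) :=
  (List.range ℓ).flatMap fun x => ((List.range ℓ).filter fun y =>
    y != 0 && (y * y) % ℓ == (x * x * x + ℓ * ℓ * ℓ - (D % ℓ) * x) % ℓ).map fun y => (x, y)

/-- The law at `(ℓ, D)`: for every such point, halvable iff `x` or `D` is a square mod `ℓ`. -/
def lawHolds (ℓ D : ℕ) : Bool :=
  let t := sqTable ℓ
  (ratPointsOddOrder ℓ D).all fun p => halvable ℓ D t p.1 == (isSqMod ℓ p.1 || isSqMod ℓ D)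

/-- The law at `ℓ` for every residue `D ∈ [1, ℓ)`. -/
def lawHoldsAllD (ℓ : ℕ) : Bool := ((List.range ℓ).filter (· != 0)).all fun D => lawHolds ℓ D

/-- `#E_D(𝔽_ℓ[i])` (with the point at infinity). -/
def cardPoints (ℓ D : ℕ) : ℕ :=
  let t := sqTable ℓ
  1 + ((giAll ℓ).map fun u =>
    let w := rhs ℓ D u
    if w = (0, 0) then 1 else if isNonzeroSquareGI ℓ t w then 2 else 0).sum

/-- Number of roots of `x³ − Dx` in `𝔽_ℓ[i]`. -/
def twoTorsionCount (ℓ D : ℕ) : ℕ := ((giAll ℓ).filter fun u => rhs ℓ D u = (0, 0)).length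

def smallPrimes : List ℕ := [3, 7, 11, 19, 23]
def mediumPrimes : List ℕ := [31, 43, 47, 59]

/-! ## Results -/

/-- `−1` is a non-residue: `𝔽_ℓ[i]` is a field for every `ℓ` used. -/
theorem model_is_field :
    ((smallPrimes ++ mediumPrimes).all fun ℓ => (List.range ℓ).all fun r => (r * r + 1) % ℓ != 0) = true := by
  native_decide

/-- Supersingular count: `#E_D(𝔽_{ℓ²}) = (ℓ+1)²` for all `D ∈ [1, ℓ)`, small `ℓ`. -/
theorem card_points_small :
    (smallPrimes.all fun ℓ => ((List.range ℓ).filter (· != 0)).all fun D =>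
      cardPoints ℓ D == (ℓ + 1) ^ 2) = true := by
  native_decide

/-- Full `2`-torsion over `𝔽_{ℓ²}`: `x³ − Dx` splits, small `ℓ`. -/
theorem two_torsion_rational :
    (smallPrimes.all fun ℓ => ((List.range ℓ).filter (· != 0)).all fun D =>
      twoTorsionCount ℓ D == 3) = true := by
  native_decide

/-- The card's hand check at `(ℓ, D) = (7, 3)`: `(2,3), (6,3) ∈ E_3(𝔽_7)`; the first is halvable, the second is not. -/
theorem card_hand_example :
    (ratPointsOddOrder 7 3).elem (2, 3) = true ∧ (ratPointsOddOrder 7 3).elem (6, 3) = true ∧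
    halvable 7 3 (sqTable 7) 2 = true ∧ halvable 7 3 (sqTable 7) 6 = false := by
  native_decide

/-- THE HALVING LAW, `ℓ ∈ {3, 7, 11, 19, 23}`, every `D ≢ 0 (mod ℓ)`, every affine `𝔽_ℓ`-point with `y ≠ 0`. -/
theorem halving_law_small : (smallPrimes.all lawHoldsAllD) = true := by
  native_decide

/-- THE HALVING LAW, `ℓ ∈ {31, 43, 47, 59}` (cost `≈ ℓ⁴` ring operations per prime; larger `ℓ` only lengthen the farm run). -/
theorem halving_law_medium : (mediumPrimes.all lawHoldsAllD) = true := by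
  native_decide

/-- K1's blind bit: every unit of `𝔽_ℓ` is a square in `𝔽_ℓ[i]` (so `δ_π` of a rational point with unit
`x`-coordinate is locally trivial at the inert prime). -/
theorem blind_bit :
    ((smallPrimes ++ mediumPrimes).all fun ℓ =>
      ((List.range ℓ).filter (· != 0)).all fun x => isNonzeroSquareGI ℓ (sqTable ℓ) (x, 0)) = true := by
  native_decide

/-- Non-vacuity: the number of tested points `Σ_D #{(x,y) ∈ E_D(𝔽_ℓ) : y ≠ 0}` per small `ℓ`
(each `E_D(𝔽_ℓ)` has `ℓ + 1` points, `4` or `2` of them `2`-torsion according as `(D/ℓ) = ±1`). -/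
theorem tested_points_small :
    (smallPrimes.map fun ℓ => (((List.range ℓ).filter (· != 0)).map fun D =>
      (ratPointsOddOrder ℓ D).length).sum) = [2, 30, 90, 306, 462] := by
  native_decide

end Summit.BirchSwinnertonDyer.BirchSwinnertonDyer.Cruxes.UpperOffV0HSYPlus.QuarticFlipKummer.HalvingCensus
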